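import Literature.AlgebraicTopology.SingularHomology.TorusPontryaginProductStructure
import Literature.AlgebraicTopology.SingularHomology.TorusCohomologyIntegral
import Mathlib.GroupTheory.Perm.Fin
import HarnessLib

/-!
# Permuting the circles of a Pontryagin monomial: `λ_{w∘σ} = sign σ · λ_w`; anti-commutativity
# `λ_a ⋆ λ_b = -λ_b ⋆ λ_a`; the duality `D : λ_I ↦ ξ_I` and `D(σ ⋆ τ) = Dσ ⌣ Dτ` (Lange 2023, §2.5.3)

Topic `Literature/AlgebraicTopology/SingularHomology`; sequel of `TorusPontryaginProductStructure.lean`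
(`λ_I ⋆ λ_J = λ_{IJ}`, associativity, vanishing for repeated circles). For the real torus
`Tⁿ = (ℝ/ℤ)ⁿ` with coordinate classes `ξᵢ ∈ H¹(Tⁿ; ℤ)` and coordinate circles `λᵢ ∈ H₁(Tⁿ; ℤ)`:

* `cupMonomial_comp_perm` (any space, any commutative coefficient ring, any family of degree-one
  classes): **`x_{w σ(0)} ⌣ ⋯ ⌣ x_{w σ(d-1)} = sign σ · (x_{w 0} ⌣ ⋯ ⌣ x_{w (d-1)})`** — graded
  commutativity of the cup product in degree one (Hatcher 2002, Thm. 3.11 / Example 3.16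
  "`αᵢαⱼ = -αⱼαᵢ`"), through adjacent transpositions;
* `cupProduct_torusXi_self_int` (`ξᵢ ⌣ ξᵢ = 0` over `ℤ`) and `torusMonomial_int_eq_zero_of_apply_eq`
  (`ξ_w = 0` for a word with a repeated letter, over `ℤ`);
* `map_torusWordHom_perm_topMonomial`: the coordinate permutation `φ_σ : Tᵈ⁺¹ → Tᵈ⁺¹` acts on the top
  monomial `λ₀ ⋆ ⋯ ⋆ λ_d` by `sign σ`; hence **`pontryaginMonomial_comp_perm`:
  `λ_{w σ(0)} ⋆ ⋯ ⋆ λ_{w σ(d)} = sign σ · (λ_{w 0} ⋆ ⋯ ⋆ λ_{w d})`** and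
  **`addPontryagin_torusLambda_comm`: `λ_a ⋆ λ_b = -(λ_b ⋆ λ_a)`** (Lange 2023, Lemma 2.5.11
  "`σ ⋆ τ = (-1)^{pq} τ ⋆ σ`", Exercise 1.1.6 (11)(b)(iii), in degrees `p = q = 1`);
* `pontryaginDual n k : Hₖ₊₁(Tⁿ; ℤ) ≃ₗ[ℤ] Hᵏ⁺¹(Tⁿ; ℤ)`, `λ_I ↦ ξ_I` on increasing words — Lange's
  "`D : H_p(X, ℤ) → Hᵖ(X, ℤ)`, defined by `λ_I ↦ dx_I`, is an isomorphism for every `p`" (p. 134) —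
  with `pontryaginDual_pontryaginMonomial`: `D(λ_w) = ξ_w` for EVERY word `w`, and
  **`pontryaginDual_addPontryagin`: `D(σ ⋆ τ) = D σ ⌣ D τ`** — **Prop. 2.5.13** "The Pontryagin product
  in homology is dual to the cup product in cohomology" (diagram (2.9));
* `addPontryagin_comm`: **`σ ⋆ τ = (-1)^{pq} τ ⋆ σ`** on `H_{≥1}(Tⁿ; ℤ)` — Lemma 2.5.11 — transported
  from the graded commutativity of the cup product through `D`.

Everything is proved; the only definitions (with bodies) are `torusLine` and `pontryaginDual`; no named fact.

## References

* [Lange2023AbelianVarietiesComplex] H. Lange, *Abelian Varieties over the Complex Numbers* (2023),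
  §2.5.3 pp. 132–134: Lemma 2.5.11, Lemma 2.5.12, Prop. 2.5.13 and diagram (2.9); Exercise 1.1.6 (11)–(12).
* [HatcherAT2002] A. Hatcher, *Algebraic Topology* (2002), Thm. 3.11, §3.2 Example 3.16, §3.B, §3.C.
-/

noncomputable section

open CategoryTheory Module

universe u v

namespace Literature.AlgebraicTopology.SingularHomology

open singularHomology

/-! ### Permuting the factors of a cup monomial of degree-one classes -/

section CupPerm

variable {R : Type v} [CommRing R] {Y : Type u} [TopologicalSpace Y] {n : ℕ}
variable (x : Fin n → singularCohomology R R Y 1)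

/-- `a ⌣ b = -(b ⌣ a)` for classes of degree one (Hatcher 2002, Thm. 3.11). [cite: HatcherAT2002, Thm. 3.11] -/
theorem cupProduct_comm_of_one (a b : singularCohomology R R Y 1) :
    cupProduct (rfl : 1 + 1 = 1 + 1) a b = -cupProduct (rfl : 1 + 1 = 1 + 1) b a := by
  rw [cupProduct_gradedComm_holds R Y rfl rfl a b, mul_one, pow_one, neg_one_smul]

/-- Transposing the LAST two factors of a cup monomial of degree-one classes changes the sign.
[cite: HatcherAT2002, §3.2 Example 3.16] -/
theorem cupMonomial_comp_swap_last (d : ℕ) (w : Fin (d + 2) → Fin n) :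
    cupMonomial x (d + 2) (w ∘ Equiv.swap (Fin.last d).castSucc (Fin.last (d + 1))) =
      -cupMonomial x (d + 2) w := by
  set p : Fin (d + 2) := (Fin.last d).castSucc
  set q : Fin (d + 2) := Fin.last (d + 1)
  have hpq : p ≠ q := (Fin.castSucc_lt_last _).ne
  have h1 : (w ∘ Equiv.swap p q) ∘ Fin.castSucc ∘ Fin.castSucc = w ∘ Fin.castSucc ∘ Fin.castSucc := by
    funext j
    simp only [Function.comp_apply]
    rw [Equiv.swap_apply_of_ne_of_ne]
    · exact fun h ↦ (Fin.castSucc_lt_last j).ne (Fin.castSucc_injective _ h)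
    · exact (Fin.castSucc_lt_last _).ne
  have h2 : (w ∘ Equiv.swap p q) (Fin.castSucc (Fin.last d)) = w q := by
    simp only [Function.comp_apply]; rw [Equiv.swap_apply_left]
  have h3 : (w ∘ Equiv.swap p q) (Fin.last (d + 1)) = w p := by
    simp only [Function.comp_apply]; rw [Equiv.swap_apply_right]
  rw [cupMonomial_succ, cupMonomial_succ, cupMonomial_succ x (d + 1) w, cupMonomial_succ x d]
  change cupProduct rfl (cupProduct rfl (cupMonomial x d ((w ∘ Equiv.swap p q) ∘ Fin.castSucc ∘ Fin.castSucc))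
      (x ((w ∘ Equiv.swap p q) (Fin.castSucc (Fin.last d))))) (x ((w ∘ Equiv.swap p q) (Fin.last (d + 1)))) =
    -cupProduct rfl (cupProduct rfl (cupMonomial x d (w ∘ Fin.castSucc ∘ Fin.castSucc)) (x (w p))) (x (w q))
  rw [h1, h2, h3, cupProduct_assoc rfl rfl rfl rfl, cupProduct_assoc rfl rfl rfl rfl, cupProduct_comm_of_one (x (w q)),
    map_neg]

/-- Transposing two ADJACENT factors of a cup monomial of degree-one classes changes the sign.
[cite: HatcherAT2002, §3.2 Example 3.16] -/
theorem cupMonomial_comp_swap_castSucc_succ :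
    ∀ (d : ℕ) (w : Fin (d + 2) → Fin n) (i : Fin (d + 1)),
      cupMonomial x (d + 2) (w ∘ Equiv.swap i.castSucc i.succ) = -cupMonomial x (d + 2) w
  | 0, w, i => by
    obtain rfl : i = Fin.last 0 := Subsingleton.elim (α := Fin 1) _ _
    exact cupMonomial_comp_swap_last x 0 w
  | d + 1, w, i => by
    by_cases hi : i = Fin.last (d + 1)
    · subst hi
      exact cupMonomial_comp_swap_last x (d + 1) w
    · obtain ⟨i', rfl⟩ := Fin.exists_castSucc_eq.mpr hi
      have hs : (w ∘ Equiv.swap i'.castSucc.castSucc i'.castSucc.succ) ∘ Fin.castSucc =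
          (w ∘ Fin.castSucc) ∘ Equiv.swap i'.castSucc i'.succ := by
        funext j
        simp only [Function.comp_apply]
        rw [Fin.succ_castSucc, (Fin.castSucc_injective _).swap_apply]
      have hlast : (w ∘ Equiv.swap i'.castSucc.castSucc i'.castSucc.succ) (Fin.last (d + 1 + 1)) =
          w (Fin.last (d + 1 + 1)) := by
        simp only [Function.comp_apply]
        rw [Fin.succ_castSucc, Equiv.swap_apply_of_ne_of_ne (Fin.castSucc_lt_last _).ne' (Fin.castSucc_lt_last _).ne']
      rw [cupMonomial_succ, cupMonomial_succ x (d + 1 + 1) w, hs, hlast,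
        cupMonomial_comp_swap_castSucc_succ d (w ∘ Fin.castSucc) i', map_neg, LinearMap.neg_apply]

/-- **`x_{w σ(0)} ⌣ ⋯ ⌣ x_{w σ(d-1)} = sign σ · (x_{w 0} ⌣ ⋯ ⌣ x_{w (d-1)})`** for degree-one classes
`xᵢ`, every word `w` and permutation `σ` (graded commutativity in degree one; the symmetric group is
generated by adjacent transpositions). [cite: HatcherAT2002, §3.2 Example 3.16] -/
theorem cupMonomial_comp_perm :
    ∀ (d : ℕ) (w : Fin d → Fin n) (σ : Equiv.Perm (Fin d)),
      cupMonomial x d (w ∘ σ) = ((Equiv.Perm.sign σ : ℤˣ) : ℤ) • cupMonomial x d w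
  | 0, w, σ => by
    rw [Subsingleton.elim σ 1, Equiv.Perm.sign_one, Units.val_one, one_zsmul]
    rfl
  | d + 1, w, σ => by
    have hσ : σ ∈ Submonoid.closure (Set.range fun i : Fin d ↦ Equiv.swap i.castSucc i.succ) := by
      rw [Equiv.Perm.mclosure_swap_castSucc_succ]; exact Submonoid.mem_top σ
    induction hσ using Submonoid.closure_induction generalizing w with
    | mem τ hτ =>
      obtain ⟨i, rfl⟩ := hτ
      cases d with
      | zero => exact i.elim0
      | succ d =>
        have hne : i.castSucc ≠ i.succ := Fin.castSucc_lt_succ.ne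
        rw [cupMonomial_comp_swap_castSucc_succ x d w i, Equiv.Perm.sign_swap hne,
          Units.val_neg, Units.val_one, neg_one_zsmul]
    | one =>
      rw [Equiv.Perm.sign_one, Units.val_one, one_zsmul]
      rfl
    | mul σ τ _ _ ihσ ihτ =>
      rw [Equiv.Perm.coe_mul, ← Function.comp_assoc, ihτ, ihσ, ← mul_zsmul, map_mul, Units.val_mul, mul_comm]

end CupPerm

/-! ### `ξᵢ ⌣ ξᵢ = 0` and `ξ_w = 0` for repeated letters, over `ℤ` -/

section TorusCup

variable {n : ℕ}

/-- `H²(T¹; ℤ) = 0` (no `2`-subsets of `Fin 1`). [cite: HatcherAT2002, §3.2 Example 3.16] -/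
theorem subsingleton_singularCohomology_torus_one_two : Subsingleton (singularCohomology ℤ ℤ (Torus 1) 2) := by
  haveI : IsEmpty (Set.powersetCard (Fin 1) 2) := by
    rw [← Fintype.card_eq_zero_iff, card_powersetCard_fin]; rfl
  exact (torusMonomialBasisInt' 1 2).repr.toEquiv.subsingleton_congr.2 inferInstance

variable (n) in
/-- The projection `Tⁿ → T¹` onto the `i`-th circle. [cite: HatcherAT2002, §3.2 Example 3.16] -/
def torusLine (i : Fin n) : C(Torus n, Torus 1) where
  toFun x _ := x i
  continuous_toFun := continuous_pi fun _ ↦ continuous_apply i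

/-- `p₀ ∘ torusLine i = pᵢ`. [cite: HatcherAT2002, §3.2 Example 3.16] -/
theorem torusProj_comp_torusLine (i : Fin n) : (torusProj 1 0).comp (torusLine n i) = torusProj n i := rfl

/-- **`ξᵢ ⌣ ξᵢ = 0` in `H²(Tⁿ; ℤ)`** (Hatcher Example 3.16, "`αᵢ² = 0`"): pulled back from
`H²(T¹; ℤ) = 0`. [cite: HatcherAT2002, §3.2 Example 3.16] -/
theorem cupProduct_torusXi_self_int (i : Fin n) :
    cupProduct (rfl : 1 + 1 = 1 + 1) (torusXi ℤ n i) (torusXi ℤ n i) = 0 := by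
  haveI := subsingleton_singularCohomology_torus_one_two
  have h : torusXi ℤ n i = singularCohomology.map ℤ ℤ (torusLine n i) 1 (torusXi ℤ 1 0) := by
    rw [torusXi, torusXi, ← ModuleCat.comp_apply, ← singularCohomology.map_comp, torusProj_comp_torusLine]
  rw [h, ← cupProduct_map, Subsingleton.elim (cupProduct rfl (torusXi ℤ 1 0) (torusXi ℤ 1 0)) 0, map_zero]

/-- **`ξ_w = 0` in `Hᵈ⁺²(Tⁿ; ℤ)` for a word `w` with `w i = w j`, `i ≠ j`** (`αᵢ² = 0` after permuting
the two equal letters to the end). [cite: HatcherAT2002, §3.2 Example 3.16] -/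
theorem torusMonomial_int_eq_zero_of_apply_eq {d : ℕ} (w : Fin (d + 2) → Fin n) {i j : Fin (d + 2)} (hij : i ≠ j)
    (hw : w i = w j) : torusMonomial ℤ n (d + 2) w = 0 := by
  classical
  set q : Fin (d + 2) := Fin.last (d + 1) with hq
  set p : Fin (d + 2) := (Fin.last d).castSucc with hp
  have hpq : q ≠ p := (Fin.castSucc_lt_last _).ne'
  set σ₁ : Equiv.Perm (Fin (d + 2)) := Equiv.swap q j
  have hqi : q ≠ σ₁ i := by
    intro h
    apply hij
    have := congrArg σ₁ h
    rwa [Equiv.swap_apply_self, Equiv.swap_apply_left, eq_comm] at this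
  set σ : Equiv.Perm (Fin (d + 2)) := σ₁ * Equiv.swap p (σ₁ i)
  have hσp : σ (Fin.castSucc (Fin.last d)) = i := by
    rw [← hp, Equiv.Perm.mul_apply, Equiv.swap_apply_left, Equiv.swap_apply_self]
  have hσq : σ (Fin.last (d + 1)) = j := by
    rw [← hq, Equiv.Perm.mul_apply, Equiv.swap_apply_of_ne_of_ne hpq hqi, Equiv.swap_apply_left]
  have h0 : torusMonomial ℤ n (d + 2) (w ∘ σ) = 0 := by
    rw [torusMonomial, cupMonomial_succ, cupMonomial_succ, cupProduct_assoc rfl rfl rfl rfl]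
    simp only [Function.comp_apply]
    rw [hσp, hσq, hw, cupProduct_torusXi_self_int, map_zero]
  have h := cupMonomial_comp_perm (torusXi ℤ n) (d + 2) w σ
  rw [← torusMonomial, ← torusMonomial, h0] at h
  rcases Int.units_eq_one_or (Equiv.Perm.sign σ) with hs | hs
  · rw [hs, Units.val_one, one_zsmul] at h
    exact h.symm
  · rw [hs, Units.val_neg, Units.val_one, neg_one_zsmul, zero_eq_neg] at h
    exact h

/-- **`ξ_w = 0` for a non-injective word** (over `ℤ`). [cite: HatcherAT2002, §3.2 Example 3.16] -/
theorem torusMonomial_int_eq_zero_of_not_injective' {d : ℕ} (w : Fin d → Fin n) (hw : ¬Function.Injective w) :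
    torusMonomial ℤ n d w = 0 := by
  obtain ⟨i, j, hwij, hij⟩ : ∃ i j, w i = w j ∧ i ≠ j := by
    simpa [Function.Injective] using hw
  match d, w, i, j with
  | 0, _, i, _ => exact i.elim0
  | 1, _, i, j => exact absurd (Subsingleton.elim i j) hij
  | d + 2, w, i, j => exact torusMonomial_int_eq_zero_of_apply_eq w hij hwij

end TorusCup

/-! ### Permuting the circles of a Pontryagin monomial -/

section HomologyPerm

variable {n d : ℕ}

/-- The coordinate permutation `φ_σ` satisfies `p_a ∘ φ_σ = p_{σ⁻¹ a}`. [cite: Lange2023AbelianVarietiesComplex, Exercise 1.1.6 (11)–(12) (held p0028)] -/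
theorem torusProj_comp_torusWordHom_perm (σ : Equiv.Perm (Fin d)) (a : Fin d) :
    (torusProj d a).comp (torusWordHom σ) = torusProj d (σ.symm a) := by
  ext x : 1
  rw [ContinuousMap.comp_apply, torusProj_apply, torusProj_apply, torusWordHom_apply, Finset.sum_apply,
    Finset.sum_eq_single (σ.symm a) (fun i _ hi ↦ Pi.single_eq_of_ne (fun h ↦ hi (by rw [h, Equiv.symm_apply_apply])) _)
      (fun h ↦ absurd (Finset.mem_univ _) h), Equiv.apply_symm_apply, Pi.single_eq_same]

/-- `φ_σ^* ξ_a = ξ_{σ⁻¹ a}`. [cite: HatcherAT2002, §3.2 Example 3.16] -/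
theorem map_torusWordHom_perm_torusXi (σ : Equiv.Perm (Fin d)) (a : Fin d) :
    singularCohomology.map ℤ ℤ (torusWordHom σ) 1 (torusXi ℤ d a) = torusXi ℤ d (σ.symm a) := by
  rw [torusXi, torusXi, ← ModuleCat.comp_apply, ← singularCohomology.map_comp, torusProj_comp_torusWordHom_perm]

/-- **`φ_σ^* (ξ₀ ⌣ ⋯ ⌣ ξ_{d-1}) = sign σ · (ξ₀ ⌣ ⋯ ⌣ ξ_{d-1})`**. [cite: HatcherAT2002, §3.2 Example 3.16] -/
theorem map_torusWordHom_perm_torusTop (σ : Equiv.Perm (Fin d)) :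
    singularCohomology.map ℤ ℤ (torusWordHom σ) d (torusTop ℤ d) = ((Equiv.Perm.sign σ : ℤˣ) : ℤ) • torusTop ℤ d := by
  rw [torusTop, torusMonomial, map_cupMonomial]
  have h : (fun a ↦ singularCohomology.map ℤ ℤ (torusWordHom σ) 1 (torusXi ℤ d a)) = torusXi ℤ d ∘ σ.symm :=
    funext fun a ↦ map_torusWordHom_perm_torusXi σ a
  rw [h, cupMonomial_comp, ← Equiv.Perm.sign_symm σ]
  exact cupMonomial_comp_perm (torusXi ℤ d) d id σ.symm

/-- The Kronecker pairing commutes with integer multiples of the cohomology class (bilinearity).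
[cite: HatcherAT2002, §3.1 p. 198] -/
theorem kroneckerPairing_zsmul_left {X : Type u} [TopologicalSpace X] {k : ℕ} (c : ℤ) (a : singularCohomology ℤ ℤ X k)
    (y : singularHomology ℤ ℤ X k) : kroneckerPairing ℤ ℤ X k (c • a) y = c • kroneckerPairing ℤ ℤ X k a y :=
  map_zsmul (AddMonoidHom.mk' (fun a : singularCohomology ℤ ℤ X k ↦ kroneckerPairing ℤ ℤ X k a y)
    fun a b ↦ by rw [map_add, LinearMap.add_apply]) c a

/-- **`(φ_σ)_* (λ₀ ⋆ ⋯ ⋆ λ_d) = sign σ · (λ₀ ⋆ ⋯ ⋆ λ_d)`** in `H_{d+1}(Tᵈ⁺¹; ℤ)` (pair with the top cup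
monomial). [cite: Lange2023AbelianVarietiesComplex, §2.5.3 Lemma 2.5.11 (held p0132–p0133)] -/
theorem map_torusWordHom_perm_topMonomial (σ : Equiv.Perm (Fin (d + 1))) :
    singularHomology.map ℤ ℤ (torusWordHom σ) (d + 1) (topMonomial d) =
      ((Equiv.Perm.sign σ : ℤˣ) : ℤ) • topMonomial d := by
  classical
  refine (monomialEval_bijective (n := d + 1) (k := d)).1 (funext fun t ↦ ?_)
  rw [monomialEval, LinearMap.pi_apply, LinearMap.pi_apply]
  have ht : torusMonomial ℤ (d + 1) (d + 1) (subsetEmb t) = torusTop ℤ (d + 1) := by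
    rw [subsetEmb_eq_id]; rfl
  rw [ht, ← kroneckerPairing_map, map_torusWordHom_perm_torusTop, kroneckerPairing_zsmul_left, map_zsmul]

/-- **Permuting the circles of a Pontryagin monomial**: `λ_{w σ(0)} ⋆ ⋯ ⋆ λ_{w σ(d)} = sign σ · (λ_{w 0} ⋆ ⋯ ⋆ λ_{w d})`
(Lange 2023, Lemma 2.5.11 / Exercise 1.1.6 (11)(b)(iii): the Pontryagin ring of a commutative Lie group is
graded-commutative). [cite: Lange2023AbelianVarietiesComplex, §2.5.3 Lemma 2.5.11 (held p0132–p0133)] -/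
theorem pontryaginMonomial_comp_perm (w : Fin (d + 1) → Fin n) (σ : Equiv.Perm (Fin (d + 1))) :
    pontryaginMonomial n d (w ∘ σ) = ((Equiv.Perm.sign σ : ℤˣ) : ℤ) • pontryaginMonomial n d w := by
  rw [pontryaginMonomial_eq_map_torusWordHom, pontryaginMonomial_eq_map_torusWordHom w, ← torusWordHom_comp w σ,
    singularHomology.map_comp, ModuleCat.comp_apply, map_torusWordHom_perm_topMonomial, map_zsmul]

/-- The monomial of a two-letter word: `λ_{e 0} ⋆ λ_{e 1}`. [cite: Lange2023AbelianVarietiesComplex, §2.5.3 (held p0133 L15–L17)] -/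
theorem pontryaginMonomial_one (e : Fin 2 → Fin n) :
    pontryaginMonomial n 1 e = addPontryagin ℤ (Torus n) rfl (torusLambda n (e 0)) (torusLambda n (e 1)) := rfl

/-- **Anti-commutativity in degree one: `λ_a ⋆ λ_b = -(λ_b ⋆ λ_a)`** in `H₂((ℝ/ℤ)ⁿ; ℤ)` (Lange 2023,
Lemma 2.5.11 "`σ ⋆ τ = (-1)^{pq} τ ⋆ σ`" with `p = q = 1`). [cite: Lange2023AbelianVarietiesComplex, §2.5.3 Lemma 2.5.11 (held p0132–p0133)] -/
theorem addPontryagin_torusLambda_comm (a b : Fin n) :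
    addPontryagin ℤ (Torus n) rfl (torusLambda n a) (torusLambda n b) =
      -addPontryagin ℤ (Torus n) rfl (torusLambda n b) (torusLambda n a) := by
  have h := pontryaginMonomial_comp_perm (n := n) ![b, a] (Equiv.swap 0 1)
  have hw : (![b, a] : Fin 2 → Fin n) ∘ ⇑(Equiv.swap (0 : Fin 2) 1) = ![a, b] := by
    funext i; fin_cases i <;> rfl
  rw [hw, Equiv.Perm.sign_swap (by decide), Units.val_neg, Units.val_one, neg_one_zsmul, pontryaginMonomial_one,
    pontryaginMonomial_one] at h
  exact h

end HomologyPerm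

/-! ### The duality `D : λ_I ↦ ξ_I` and Proposition 2.5.13 -/

section Duality

variable {n k l m : ℕ}

/-- `ξ_{w∘σ} = sign σ · ξ_w` for the cup monomials of `Tⁿ` over `ℤ`. [cite: HatcherAT2002, §3.2 Example 3.16] -/
theorem torusMonomial_comp_perm_int {d : ℕ} (w : Fin d → Fin n) (σ : Equiv.Perm (Fin d)) :
    torusMonomial ℤ n d (w ∘ σ) = ((Equiv.Perm.sign σ : ℤˣ) : ℤ) • torusMonomial ℤ n d w :=
  cupMonomial_comp_perm (torusXi ℤ n) d w σ

variable (n k) in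
/-- **Lange's `D : Hₖ₊₁(X, ℤ) → Hᵏ⁺¹(X, ℤ)`, `λ_I ↦ dx_I`** ("According to Lemma 2.5.12, the map `D`,
defined by `λ_I ↦ dx_I`, is an isomorphism for every `p`", p. 134), for the real torus `(ℝ/ℤ)ⁿ`: the
`ℤ`-linear isomorphism matching the Pontryagin-monomial basis with the cup-monomial basis.
[cite: Lange2023AbelianVarietiesComplex, §2.5.3 Prop. 2.5.13 (p. 134)] -/
def pontryaginDual : singularHomology ℤ ℤ (Torus n) (k + 1) ≃ₗ[ℤ] singularCohomology ℤ ℤ (Torus n) (k + 1) :=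
  (pontryaginMonomialBasis n k).equiv (torusMonomialBasisInt' n (k + 1)) (Equiv.refl _)

/-- `D(λ_s) = ξ_s` on increasing words. [cite: Lange2023AbelianVarietiesComplex, §2.5.3 Prop. 2.5.13 (p. 134)] -/
theorem pontryaginDual_pontryaginMonomial_subsetEmb (s : Set.powersetCard (Fin n) (k + 1)) :
    pontryaginDual n k (pontryaginMonomial n k (subsetEmb s)) = torusMonomial ℤ n (k + 1) (subsetEmb s) := by
  rw [← pontryaginMonomialBasis_apply, pontryaginDual, Module.Basis.equiv_apply, Equiv.refl_apply, torusMonomialBasisInt'_apply]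

/-- `D` commutes with integer multiples. [cite: Lange2023AbelianVarietiesComplex, §2.5.3 Prop. 2.5.13 (p. 134)] -/
theorem pontryaginDual_zsmul (c : ℤ) (x : singularHomology ℤ ℤ (Torus n) (k + 1)) :
    pontryaginDual n k (c • x) = c • pontryaginDual n k x :=
  map_zsmul _ c x

/-- **The basis `{D λ_I} = {ξ_I}` is dual to `{λ_I}`**: `⟨D λ_s, λ_t⟩ = δ_{st}` (Lemma 2.5.12: "dual to the
basis `{dx_I}` … with respect to `σ ↦ ∫_σ`"). [cite: Lange2023AbelianVarietiesComplex, §2.5.3 Lemma 2.5.12 (p. 133)] -/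
theorem kroneckerPairing_pontryaginDual_pontryaginMonomial [DecidableEq (Set.powersetCard (Fin n) (k + 1))]
    (s t : Set.powersetCard (Fin n) (k + 1)) :
    kroneckerPairing ℤ ℤ (Torus n) (k + 1) (pontryaginDual n k (pontryaginMonomial n k (subsetEmb s)))
      (pontryaginMonomial n k (subsetEmb t)) = if s = t then 1 else 0 := by
  rw [pontryaginDual_pontryaginMonomial_subsetEmb, kroneckerPairing_torusMonomial_pontryaginMonomial]

/-- An injective word is an increasing word (an ordered multi-index, Lange p. 133) composed with a
permutation. [cite: Lange2023AbelianVarietiesComplex, §2.5.3 Lemma 2.5.12 (p. 133)] -/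
theorem exists_eq_subsetEmb_comp_perm {d : ℕ} {w : Fin d → Fin n} (hw : Function.Injective w) :
    ∃ (s : Set.powersetCard (Fin n) d) (σ : Equiv.Perm (Fin d)), w = subsetEmb s ∘ σ := by
  classical
  let s : Set.powersetCard (Fin n) d :=
    ⟨Finset.univ.image w, by
      change (Finset.univ.image w).card = d
      rw [Finset.card_image_of_injective _ hw, Finset.card_univ, Fintype.card_fin]⟩
  have hmem : ∀ i, w i ∈ s.val := fun i ↦ Finset.mem_image_of_mem w (Finset.mem_univ i)
  choose σ₀ hσ₀ using fun i ↦ exists_subsetEmb_eq s (hmem i)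
  have hinj : Function.Injective σ₀ := fun i j h ↦ hw (by rw [← hσ₀ i, ← hσ₀ j, h])
  refine ⟨s, Equiv.ofBijective σ₀ (Finite.injective_iff_bijective.mp hinj), funext fun i ↦ ?_⟩
  rw [Function.comp_apply, Equiv.ofBijective_apply, hσ₀]

/-- **`D(λ_w) = ξ_w` for every word `w`** (both vanish for a repeated letter; both pick up `sign σ`
under permutations). [cite: Lange2023AbelianVarietiesComplex, §2.5.3 Prop. 2.5.13 (p. 134)] -/
theorem pontryaginDual_pontryaginMonomial (w : Fin (k + 1) → Fin n) :
    pontryaginDual n k (pontryaginMonomial n k w) = torusMonomial ℤ n (k + 1) w := by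
  by_cases hw : Function.Injective w
  · obtain ⟨s, σ, rfl⟩ := exists_eq_subsetEmb_comp_perm hw
    rw [pontryaginMonomial_comp_perm, pontryaginDual_zsmul, pontryaginDual_pontryaginMonomial_subsetEmb,
      torusMonomial_comp_perm_int]
  · rw [pontryaginMonomial_eq_zero_of_not_injective hw, map_zero, torusMonomial_int_eq_zero_of_not_injective' w hw]

/-- **The cup monomial of a concatenated word is the cup product**: `ξ_{e e'} = ξ_e ⌣ ξ_{e'}`.
[cite: HatcherAT2002, §3.2 Example 3.16] -/
theorem torusMonomial_appendWord (h : k + 1 + (l + 1) = m + 1) (e : Fin (k + 1) → Fin n) (e' : Fin (l + 1) → Fin n) :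
    torusMonomial ℤ n (m + 1) (appendWord e e' m h) =
      cupProduct h (torusMonomial ℤ n (k + 1) e) (torusMonomial ℤ n (l + 1) e') := by
  rw [torusMonomial, torusMonomial, torusMonomial, cupMonomial_split (torusXi ℤ n) h]
  congr 2
  · congr 1
    funext i
    have hi : ((Fin.cast h (Fin.castAdd (l + 1) i) : Fin (m + 1)) : ℕ) < k + 1 := i.2
    have hi' : (⟨((Fin.cast h (Fin.castAdd (l + 1) i) : Fin (m + 1)) : ℕ), hi⟩ : Fin (k + 1)) = i := Fin.ext rfl
    rw [appendWord_apply_of_lt e e' h _ hi, hi']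
  · funext j
    have hj : k + 1 ≤ ((Fin.cast h (Fin.natAdd (k + 1) j) : Fin (m + 1)) : ℕ) := Nat.le_add_right _ _
    have hj' : (⟨((Fin.cast h (Fin.natAdd (k + 1) j) : Fin (m + 1)) : ℕ) - (k + 1), by omega⟩ : Fin (l + 1)) = j :=
      Fin.ext (Nat.add_sub_cancel_left _ _)
    rw [appendWord_apply_of_le e e' h _ hj, hj']

/-- The cup product commutes with integer multiples on the left (bilinearity). [cite: HatcherAT2002, §3.2 p. 206] -/
theorem cupProduct_zsmul_left {X : Type u} [TopologicalSpace X] {p q r : ℕ} (hpq : p + q = r) (c : ℤ)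
    (a : singularCohomology ℤ ℤ X p) (b : singularCohomology ℤ ℤ X q) :
    cupProduct hpq (c • a) b = c • cupProduct hpq a b :=
  map_zsmul (AddMonoidHom.mk' (fun a : singularCohomology ℤ ℤ X p ↦ cupProduct hpq a b)
    fun a a' ↦ by rw [map_add, LinearMap.add_apply]) c a

/-- The cup product commutes with integer multiples on the right (bilinearity). [cite: HatcherAT2002, §3.2 p. 206] -/
theorem cupProduct_zsmul_right {X : Type u} [TopologicalSpace X] {p q r : ℕ} (hpq : p + q = r) (c : ℤ)
    (a : singularCohomology ℤ ℤ X p) (b : singularCohomology ℤ ℤ X q) :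
    cupProduct hpq a (c • b) = c • cupProduct hpq a b :=
  map_zsmul (AddMonoidHom.mk' (fun b : singularCohomology ℤ ℤ X q ↦ cupProduct hpq a b) fun b b' ↦ by rw [map_add]) c b

/-- **Proposition 2.5.13: "The Pontryagin product in homology is dual to the cup product in
cohomology"** — the diagram (2.9) commutes: `D(σ ⋆ τ) = D σ ⌣ D τ` for `σ ∈ Hₖ₊₁(Tⁿ; ℤ)`,
`τ ∈ Hₗ₊₁(Tⁿ; ℤ)` ("one immediately checks from the definition of the maps": on monomials
`λ_I ⋆ λ_J = λ_{IJ} ↦ ξ_{IJ} = ξ_I ⌣ ξ_J`, then bilinearity). [cite: Lange2023AbelianVarietiesComplex, §2.5.3 Prop. 2.5.13 and (2.9) (p. 134)] -/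
theorem pontryaginDual_addPontryagin (h : k + 1 + (l + 1) = m + 1) (x : singularHomology ℤ ℤ (Torus n) (k + 1))
    (y : singularHomology ℤ ℤ (Torus n) (l + 1)) :
    pontryaginDual n m (addPontryagin ℤ (Torus n) h x y) = cupProduct h (pontryaginDual n k x) (pontryaginDual n l y) := by
  have key : ∀ (e : Fin (k + 1) → Fin n) (e' : Fin (l + 1) → Fin n),
      pontryaginDual n m (addPontryagin ℤ (Torus n) h (pontryaginMonomial n k e) (pontryaginMonomial n l e')) =
        cupProduct h (pontryaginDual n k (pontryaginMonomial n k e)) (pontryaginDual n l (pontryaginMonomial n l e')) := by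
    intro e e'
    rw [addPontryagin_pontryaginMonomial h, pontryaginDual_pontryaginMonomial, pontryaginDual_pontryaginMonomial,
      pontryaginDual_pontryaginMonomial, torusMonomial_appendWord]
  have key₁ : ∀ (e : Fin (k + 1) → Fin n) (y : singularHomology ℤ ℤ (Torus n) (l + 1)),
      pontryaginDual n m (addPontryagin ℤ (Torus n) h (pontryaginMonomial n k e) y) =
        cupProduct h (pontryaginDual n k (pontryaginMonomial n k e)) (pontryaginDual n l y) := by
    intro e y
    rw [eq_sum_zsmul_pontryaginMonomial y]
    simp only [map_sum, addPontryagin_zsmul_right, pontryaginDual_zsmul, cupProduct_zsmul_right, key]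
  rw [eq_sum_zsmul_pontryaginMonomial x]
  simp only [map_sum, LinearMap.sum_apply, addPontryagin_zsmul_left, pontryaginDual_zsmul, cupProduct_zsmul_left, key₁]

/-- **Lemma 2.5.11: `σ ⋆ τ = (-1)^{pq} τ ⋆ σ`** for `σ ∈ Hₚ(Tⁿ; ℤ)`, `τ ∈ H_q(Tⁿ; ℤ)`, `p = k + 1`,
`q = l + 1` — transported through `D` from the graded commutativity of the cup product (Lange's proof:
"the exterior homology product is anti-commutative"). [cite: Lange2023AbelianVarietiesComplex, §2.5.3 Lemma 2.5.11 (pp. 132–133)] -/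
theorem addPontryagin_comm (h : k + 1 + (l + 1) = m + 1) (h' : l + 1 + (k + 1) = m + 1)
    (x : singularHomology ℤ ℤ (Torus n) (k + 1)) (y : singularHomology ℤ ℤ (Torus n) (l + 1)) :
    addPontryagin ℤ (Torus n) h x y = ((-1 : ℤ) ^ ((k + 1) * (l + 1))) • addPontryagin ℤ (Torus n) h' y x := by
  apply (pontryaginDual n m).injective
  rw [pontryaginDual_addPontryagin, pontryaginDual_zsmul, pontryaginDual_addPontryagin,
    cupProduct_gradedComm_holds ℤ (Torus n) h h' (pontryaginDual n k x) (pontryaginDual n l y)]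
  -- the cup side carries the `ℤ`-module scalar action of the `ModuleCat` carrier, the homology side the
  -- `zsmul`; they agree (`int_smul_eq_zsmul`, the `Module ℤ` instance being found by unification)
  exact int_smul_eq_zsmul _ _ _

end Duality



end Literature.AlgebraicTopology.SingularHomology

end
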